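import Mathlib.Algebra.QuaternionBasis
import Mathlib.LinearAlgebra.Matrix.NonsingularInverse
import Mathlib.LinearAlgebra.FiniteDimensional.Lemmas
import Literature.NumberTheory.Automorphic.QuaternionAlgebraAdelic
import HarnessLib

/-!
# Splitting of `ℍ[K,a,b]` at the places of a number field; the classification (existence half)
# reduced to the quadratic norm theorem

Sibling proof file of `Literature.NumberTheory.Automorphic.QuaternionAlgebraAdelic` (namespace
`Literature.Automorphic`), all declarations fully proved. It carries out every step of the proof of the
existence half of the classification of quaternion algebras over a number field `K`
(`exists_isQuaternionAlgebra_of_even`; Vignéras, LNM 800, Ch. III §3 Thm. 3.1) *except* the one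
class-field-theoretic input, which enters as an explicit hypothesis:

* `QuaternionAlgebra.isQuaternionAlgebra_holds` : **discharge** of the named fact
  `QuaternionAlgebra.isQuaternionAlgebra` — Mathlib's `ℍ[K,a,b]` (`a b ≠ 0`, `2 ≠ 0`) is central
  (`QuaternionAlgebra.isCentral`), simple (`QuaternionAlgebra.isSimpleRing`, averaging over
  conjugation by `1, i, j, k`) and four-dimensional (Vignéras I §1, p. 2). (This discharge lived
  in `QuaternionAlgebraAdelicProofs.lean` until that file was re-purposed for Fujisaki's lemma,
  p5202; it is restored here under the same names.)
* `QuaternionAlgebra.nonempty_baseChange_algEquiv`,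
  `ScalarExtension.nonempty_algEquiv_quaternionAlgebra` : base change
  `F ⊗[K] ℍ[K,a,b] ≃ₐ[F] ℍ[F,a,b]` (Vignéras I §2, the algebra `H_F`), built from Mathlib's universal
  property `QuaternionAlgebra.lift` and `Algebra.TensorProduct.lift`;
* `QuaternionAlgebra.nonempty_algEquiv_matrix_iff` : for a field `F` with `2 ≠ 0` and `a b ≠ 0`,
  `ℍ[F,a,b] ≃ₐ[F] M₂(F)` iff `b = x² - a y²` is solvable in `F`, i.e. iff `b` is a norm from
  `F(√a)` (or `a` is a square) — Vignéras I §2 Cor. 2.4 (caractérisation des algèbres de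
  matrices): `⇐` by an explicit quaternionic basis of `M₂(F)` and simplicity of `ℍ[F,a,b]`
  (`QuaternionAlgebra.isSimpleRing`), `⇒` because the preimage of the matrix unit `E₁₁` is a
  non-zero element of reduced norm `x² - a y² - b z² + a b w² = 0`;
* `isSplitAt_quaternionAlgebra_iff`, `isSplitAtInfinite_quaternionAlgebra_iff` : hence `ℍ[K,a,b]`
  is split at a place `v` of `K` iff `b = x² - a y²` is solvable in `K_v`;
* `exists_valuation_eq_exp_neg_one_and_embedding_neg` : for a finite set `S` of finite places there
  is `a ∈ K×` with `v(a) = 1` for `v ∈ S` (Chinese remainder theorem in `𝓞 K`) and `σ_w(a) < 0` at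
  every real place `w`; such an `a` is a non-square in `K_v` (`v ∈ S`) and in `K_w` (`w` real):
  `not_isSquare_adicCompletion_of_valuation_eq_exp_neg_one`,
  `not_isSquare_completion_of_embedding_neg` (so `K(√a)` is a field locally at `S` and at the real
  places; Vignéras III §3 Lemme 3.6 in the special form needed here);
* `exists_isQuaternionAlgebra_of_even_of_exists_isLocalNorm` : **assembly** — assuming the
  consequence of the norm index theorem `[K_A^× : K^× n(L_A^×)] = 2` used by Vignéras in the proofs
  of III Thm. 3.8 and Propriété III (for `L = K(√a)` and an even set `S ∪ T` of places at which
  `a` is not a square there is `θ ∈ K×` that is a local norm from `K_v(√a)`, i.e. of the form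
  `x² - a y²` over `K_v`, exactly at the places outside `S ∪ T`), the algebra `ℍ[K,a,θ]` is a
  quaternion algebra (`QuaternionAlgebra.isQuaternionAlgebra_holds`) ramified exactly at `S ∪ T`.
  In Hilbert-symbol form the hypothesis is the named fact
  `Literature.NumberTheory.QuadraticForms.exists_hilbertSymbol_eq_neg_one_iff` (O'Meara 71:19 with 71:19a) of
  `Literature/NumberTheory/QuadraticForms/HilbertSymbolPrescribed.lean`; the sibling file
  `QuaternionAlgebraExistence.lean` translates (`(a, b)_v = 1` iff `x² - a y² = b` is solvable in
  `K_v`: `Literature.NumberTheory.QuadraticForms.exists_sq_sub_mul_sq_iff_hilbertSymbol_eq_one`) and derives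
  `exists_isQuaternionAlgebra_of_even K` from that fact; discharging the fact discharges
  `exists_isQuaternionAlgebra_of_even`. That fact in turn is reduced
  (`QuadraticForms/HilbertSymbolPrescribedProofs.lean`, O'Meara's proof of 71:19) to the norm
  index theorem `Literature.NumberTheory.QuadraticForms.normIdeles_index_eq_two` (O'Meara 65:21 = Vignéras III Thm. 3.7) and the
  local fact `Literature.NumberTheory.QuadraticForms.adicCompletion_exists_hilbertSymbol_eq_neg_one` (O'Meara 63:13) of
  `QuadraticForms/QuadraticNormIndex.lean`, together with Hilbert reciprocity
  (`Literature.NumberTheory.QuadraticForms.hilbertReciprocity`, O'Meara 71:18).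

Design: everything here is a `theorem` (equivalences of algebras are asserted as `Nonempty`, which
is all that `IsSplitAt`/`IsSplitAtInfinite` consume), so that the file is kernel-checked only.

## References

* M.-F. Vignéras, *Arithmétique des algèbres de quaternions*, LNM 800 (1980): Ch. I §1 Lemme 1.1,
  §2 Cor. 2.4; Ch. III §3 Thm. 3.1, Lemme 3.6, Thm. 3.7, Thm. 3.8.
-/

noncomputable section

open scoped TensorProduct Quaternion
open NumberField IsDedekindDomain

namespace Literature.NumberTheory.Automorphic

/-! ### `ℍ[K,a,b]` is a quaternion algebra: discharge of `QuaternionAlgebra.isQuaternionAlgebra` -/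

section IsQuaternionAlgebraHolds

variable {K : Type*} [Field K]

namespace QuaternionAlgebra

/-- Averaging over conjugation by `1, i, j, k` in `ℍ[K,a,b]` kills the pure part:
`ab·x + b·(i x i) + a·(j x j) - k x k = 4ab·x₀` (the trace form of Vignéras I §1). [folklore] -/
theorem conj_sum_eq (a b : K) (x : ℍ[K,a,b]) :
    (a * b) • x + b • ((⟨0, 1, 0, 0⟩ : ℍ[K,a,b]) * x * ⟨0, 1, 0, 0⟩)
      + a • ((⟨0, 0, 1, 0⟩ : ℍ[K,a,b]) * x * ⟨0, 0, 1, 0⟩)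
      - (⟨0, 0, 0, 1⟩ : ℍ[K,a,b]) * x * ⟨0, 0, 0, 1⟩
      = algebraMap K ℍ[K,a,b] (4 * a * b * x.re) := by
  rw [_root_.QuaternionAlgebra.algebraMap_eq]
  ext <;> simp <;> ring

/-- Every two-sided ideal of `ℍ[K,a,b]` contains `4ab·re(x)` together with `x`. [folklore] -/
theorem algebraMap_re_mem (a b : K) (I : TwoSidedIdeal ℍ[K,a,b]) {x : ℍ[K,a,b]} (hx : x ∈ I) :
    algebraMap K ℍ[K,a,b] (4 * a * b * x.re) ∈ I := by
  rw [← conj_sum_eq]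
  refine I.sub_mem (I.add_mem (I.add_mem ?_ ?_) ?_) ?_
  · rw [Algebra.smul_def]; exact I.mul_mem_left _ _ hx
  · rw [Algebra.smul_def]
    exact I.mul_mem_left _ _ (I.mul_mem_right _ _ (I.mul_mem_left _ _ hx))
  · rw [Algebra.smul_def]
    exact I.mul_mem_left _ _ (I.mul_mem_right _ _ (I.mul_mem_left _ _ hx))
  · exact I.mul_mem_right _ _ (I.mul_mem_left _ _ hx)

/-- `ℍ[K,a,b]` is a simple ring when `char K ≠ 2` and `a b ≠ 0` (Vignéras I §1, p. 2: "on peut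
vérifier facilement que H/K est une algèbre centrale simple"): a non-zero two-sided ideal contains
an element with non-zero real part (one of `x, ix, jx, kx`), hence the scalar `4ab·re ≠ 0`.
[cite: VignerasLNM800, Ch. I §1 p. 2] -/
theorem isSimpleRing [NeZero (2 : K)] {a b : K} (ha : a ≠ 0) (hb : b ≠ 0) :
    IsSimpleRing ℍ[K,a,b] := by
  refine .of_eq_bot_or_eq_top fun I ↦ ?_
  rw [or_iff_not_imp_left, ← I.one_mem_iff]
  intro H
  obtain ⟨x, hxI, hx0⟩ := SetLike.exists_of_lt (bot_lt_iff_ne_bot.mpr H : ⊥ < I)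
  have hx0 : x ≠ 0 := hx0
  have h4ab : (4 : K) * a * b ≠ 0 := by
    have h4 : (4 : K) = 2 * 2 := by norm_num
    rw [h4]
    exact mul_ne_zero (mul_ne_zero (mul_ne_zero two_ne_zero two_ne_zero) ha) hb
  suffices ∃ y ∈ I, y.re ≠ 0 by
    obtain ⟨y, hyI, hy⟩ := this
    have hmem := algebraMap_re_mem a b I hyI
    have hne : 4 * a * b * y.re ≠ 0 := mul_ne_zero h4ab hy
    have := I.mul_mem_left (algebraMap K _ (4 * a * b * y.re)⁻¹) _ hmem
    rwa [← map_mul, inv_mul_cancel₀ hne, map_one] at this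
  by_cases h0 : x.re ≠ 0
  · exact ⟨x, hxI, h0⟩
  by_cases h1 : x.imI ≠ 0
  · refine ⟨⟨0, 1, 0, 0⟩ * x, I.mul_mem_left _ _ hxI, ?_⟩
    simpa using mul_ne_zero ha h1
  by_cases h2 : x.imJ ≠ 0
  · refine ⟨⟨0, 0, 1, 0⟩ * x, I.mul_mem_left _ _ hxI, ?_⟩
    simpa using mul_ne_zero hb h2
  by_cases h3 : x.imK ≠ 0
  · refine ⟨⟨0, 0, 0, 1⟩ * x, I.mul_mem_left _ _ hxI, ?_⟩
    simpa [mul_assoc] using mul_ne_zero ha (mul_ne_zero hb h3)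
  push Not at h0 h1 h2 h3
  exact absurd (_root_.QuaternionAlgebra.ext h0 h1 h2 h3) hx0

/-- `ℍ[K,a,b]` is central over `K` when `char K ≠ 2` and `a ≠ 0` (Vignéras I §1, p. 2):
commutation with `i` and `j` forces the pure part of a central element to vanish.
[cite: VignerasLNM800, Ch. I §1 p. 2] -/
theorem isCentral [NeZero (2 : K)] {a : K} (b : K) (ha : a ≠ 0) :
    Algebra.IsCentral K ℍ[K,a,b] := by
  refine ⟨fun x hx ↦ ?_⟩
  rw [Subalgebra.mem_center_iff] at hx
  rw [Algebra.mem_bot]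
  have hi := hx ⟨0, 1, 0, 0⟩
  have hj := hx ⟨0, 0, 1, 0⟩
  simp [_root_.QuaternionAlgebra.ext_iff] at hi hj
  have h1 : x.imI = 0 := by
    have : (2 : K) * x.imI = 0 := by linear_combination -hj.2
    exact (mul_eq_zero.mp this).resolve_left two_ne_zero
  have h2 : x.imJ = 0 := by
    have : (2 : K) * x.imJ = 0 := by linear_combination hi.2
    exact (mul_eq_zero.mp this).resolve_left two_ne_zero
  have h3 : x.imK = 0 := by
    have : (2 : K) * a * x.imK = 0 := by linear_combination hi.1
    exact (mul_eq_zero.mp this).resolve_left (mul_ne_zero two_ne_zero ha)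
  refine ⟨x.re, ?_⟩
  rw [_root_.QuaternionAlgebra.algebraMap_eq]
  ext <;> simp [h1, h2, h3]

end QuaternionAlgebra

/-- **Discharge** of `QuaternionAlgebra.isQuaternionAlgebra`: Mathlib's `ℍ[K,a,b]` with `a b ≠ 0`
over a field with `2 ≠ 0` is a quaternion algebra — central (`QuaternionAlgebra.isCentral`),
simple (`QuaternionAlgebra.isSimpleRing`) and four-dimensional (Mathlib
`QuaternionAlgebra.finrank_eq_four`) (Vignéras I §1, p. 1–2). [cite: VignerasLNM800, Ch. I §1 p. 2] -/
theorem QuaternionAlgebra.isQuaternionAlgebra_holds : QuaternionAlgebra.isQuaternionAlgebra := by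
  intro K _ _ a b ha hb
  haveI := QuaternionAlgebra.isCentral (K := K) b ha
  exact { isSimpleRing := QuaternionAlgebra.isSimpleRing ha hb
          finrank_eq_four := _root_.QuaternionAlgebra.finrank_eq_four a 0 b }

end IsQuaternionAlgebraHolds

/-! ### Base change of `ℍ[K,a,b]` -/

section BaseChange

variable (K F : Type*) [Field K] [CommRing F] [Algebra K F] (a b : K)

/-- **Base change of quaternion algebras**: for a commutative `K`-algebra `F`,
`F ⊗[K] ℍ[K,a,b] ≃ₐ[F] ℍ[F,a,b]` (the algebra `H_F` of Vignéras I §2). The equivalence sends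
`f ⊗ q` to `f · q`; it is assembled from the quaternionic basis `1 ⊗ i, 1 ⊗ j` of the tensor
product (Mathlib `QuaternionAlgebra.Basis.liftHom`) and from `Algebra.TensorProduct.lift` of the
coefficient extension `ℍ[K,a,b] →ₐ[K] ℍ[F,a,b]`. [cite: VignerasLNM800, Ch. I §2 (l'algèbre H_F)] -/
theorem QuaternionAlgebra.nonempty_baseChange_algEquiv :
    Nonempty (F ⊗[K] ℍ[K,a,b] ≃ₐ[F] ℍ[F, algebraMap K F a, algebraMap K F b]) := by
  -- the structure map `K → ℍ[F,a,b]` is `s ↦ (s, 0, 0, 0)` (definitional)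
  have hmap : ∀ s : K,
      algebraMap K ℍ[F, algebraMap K F a, algebraMap K F b] s = ⟨algebraMap K F s, 0, 0, 0⟩ :=
    fun _ ↦ rfl
  -- the standard quaternionic basis of `ℍ[F,a,b]` over `K`: its lift is the coefficient extension
  let qK : _root_.QuaternionAlgebra.Basis (R := K) ℍ[F, algebraMap K F a, algebraMap K F b] a 0 b :=
    { i := ⟨0, 1, 0, 0⟩, j := ⟨0, 0, 1, 0⟩, k := ⟨0, 0, 0, 1⟩
      i_mul_i := by ext <;> simp [Algebra.smul_def, hmap]
      j_mul_j := by ext <;> simp [Algebra.smul_def, hmap]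
      i_mul_j := by ext <;> simp
      j_mul_i := by ext <;> simp }
  -- the quaternionic basis `1 ⊗ i, 1 ⊗ j, 1 ⊗ k` of `F ⊗ ℍ[K,a,b]` over `F`
  let qF : _root_.QuaternionAlgebra.Basis (R := F) (F ⊗[K] ℍ[K,a,b]) (algebraMap K F a) 0
      (algebraMap K F b) :=
    { i := 1 ⊗ₜ ⟨0, 1, 0, 0⟩, j := 1 ⊗ₜ ⟨0, 0, 1, 0⟩, k := 1 ⊗ₜ ⟨0, 0, 0, 1⟩
      i_mul_i := by
        rw [Algebra.TensorProduct.tmul_mul_tmul, one_mul, zero_smul, add_zero, algebraMap_smul,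
          Algebra.TensorProduct.one_def, ← TensorProduct.tmul_smul]
        congr 1
        ext <;> simp [Algebra.smul_def]
      j_mul_j := by
        rw [Algebra.TensorProduct.tmul_mul_tmul, one_mul, algebraMap_smul,
          Algebra.TensorProduct.one_def, ← TensorProduct.tmul_smul]
        congr 1
        ext <;> simp [Algebra.smul_def]
      i_mul_j := by
        rw [Algebra.TensorProduct.tmul_mul_tmul, one_mul]
        congr 1
        ext <;> simp
      j_mul_i := by
        rw [Algebra.TensorProduct.tmul_mul_tmul, one_mul, zero_smul, zero_sub,
          ← TensorProduct.tmul_neg]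
        congr 1
        ext <;> simp }
  have hqK : ∀ q : ℍ[K,a,b], qK.liftHom q =
      ⟨algebraMap K F q.re, algebraMap K F q.imI, algebraMap K F q.imJ, algebraMap K F q.imK⟩ := by
    intro q
    simp only [QuaternionAlgebra.Basis.liftHom_apply, QuaternionAlgebra.Basis.lift, qK]
    ext <;> simp [hmap, Algebra.smul_def]
  let fwd : F ⊗[K] ℍ[K,a,b] →ₐ[F] ℍ[F, algebraMap K F a, algebraMap K F b] :=
    Algebra.TensorProduct.lift (Algebra.ofId F _) qK.liftHom
      (fun x _ ↦ _root_.QuaternionAlgebra.coe_commute x _)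
  refine ⟨AlgEquiv.ofAlgHom fwd qF.liftHom ?_ ?_⟩
  · apply _root_.QuaternionAlgebra.lift.symm.injective
    ext1 <;> simp [fwd, qF, hqK, QuaternionAlgebra.Basis.lift, Algebra.ofId_apply]
  · ext
    · simp [fwd, qF, hqK, QuaternionAlgebra.Basis.lift, Algebra.ofId_apply]
    · simp [fwd, qF, hqK, QuaternionAlgebra.Basis.lift, Algebra.ofId_apply]

/-- Base change for the type synonym `ScalarExtension K F ℍ[K,a,b] = F ⊗[K] ℍ[K,a,b]` (with its
`F`-algebra structure `ScalarExtension.instAlgebra`): `ScalarExtension K F ℍ[K,a,b] ≃ₐ[F] ℍ[F,a,b]`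
(Vignéras I §2, `H_F`). [folklore] -/
theorem ScalarExtension.nonempty_algEquiv_quaternionAlgebra :
    Nonempty (ScalarExtension K F ℍ[K,a,b] ≃ₐ[F] ℍ[F, algebraMap K F a, algebraMap K F b]) :=
  let ⟨e⟩ := QuaternionAlgebra.nonempty_baseChange_algEquiv K F a b
  ⟨(ScalarExtension.ofTensor K F ℍ[K,a,b]).symm.trans e⟩

end BaseChange

/-! ### The splitting criterion `ℍ[F,a,b] ≃ M₂(F) ⟺ b ∈ N(F(√a))` -/

section Splitting

variable {F : Type*} [Field F]

namespace QuaternionAlgebra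

/-- The reduced norm form: for `q = x + y i + z j + w k ∈ ℍ[F,a,b]`,
`q q̄ = x² - a y² - b z² + a b w²` (Vignéras I §1, `n(h) = h h̄`). [folklore] -/
theorem self_mul_star_eq_algebraMap (a b : F) (q : ℍ[F,a,b]) :
    q * star q = algebraMap F ℍ[F,a,b]
      (q.re ^ 2 - a * q.imI ^ 2 - b * q.imJ ^ 2 + a * b * q.imK ^ 2) := by
  rw [_root_.QuaternionAlgebra.algebraMap_eq]
  ext <;> simp <;> ring

/-- An element of `ℍ[F,a,b]` with non-zero reduced norm `x² - a y² - b z² + a b w²` is invertible,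
with inverse `n(q)⁻¹ q̄` (Vignéras I §1, Lemme 1.1). [cite: VignerasLNM800, Ch. I §1 Lemme 1.1] -/
theorem isUnit_of_normForm_ne_zero {a b : F} (q : ℍ[F,a,b])
    (h : q.re ^ 2 - a * q.imI ^ 2 - b * q.imJ ^ 2 + a * b * q.imK ^ 2 ≠ 0) : IsUnit q := by
  set N := q.re ^ 2 - a * q.imI ^ 2 - b * q.imJ ^ 2 + a * b * q.imK ^ 2 with hN
  have h1 : q * (N⁻¹ • star q) = 1 := by
    rw [mul_smul_comm, self_mul_star_eq_algebraMap, ← hN, Algebra.smul_def, ← map_mul,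
      inv_mul_cancel₀ h, map_one]
  have h2 : (N⁻¹ • star q) * q = 1 := by
    rw [smul_mul_assoc, star_comm_self', self_mul_star_eq_algebraMap, ← hN, Algebra.smul_def,
      ← map_mul, inv_mul_cancel₀ h, map_one]
  exact isUnit_iff_exists.mpr ⟨N⁻¹ • star q, h1, h2⟩

/-- If the quaternary norm form `x² - a y² - b z² + a b w²` (`a ≠ 0`, `2 ≠ 0`) has a non-trivial
zero then `b` is represented by the binary form `X² - a Y²`: if `z² - a w² ≠ 0` divide (the binary
form is multiplicative), otherwise `a = c²` is a square and `b = ((1+b)/2)² - c² ((1-b)/(2c))²`.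
[folklore] -/
theorem exists_sq_sub_mul_sq_of_normForm_eq_zero [NeZero (2 : F)] {a b : F} (ha : a ≠ 0)
    {x y z w : F} (h : x ^ 2 - a * y ^ 2 - b * z ^ 2 + a * b * w ^ 2 = 0)
    (hne : ¬ (x = 0 ∧ y = 0 ∧ z = 0 ∧ w = 0)) :
    ∃ X Y : F, X ^ 2 - a * Y ^ 2 = b := by
  by_cases hzw : z ^ 2 - a * w ^ 2 = 0
  · -- then `a` is a non-zero square `c²`, and `b = ((1+b)/2)² - c² ((1-b)/(2c))²`
    have hxy : x ^ 2 - a * y ^ 2 = 0 := by linear_combination h + b * hzw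
    obtain ⟨c, hc0, hc⟩ : ∃ c : F, c ≠ 0 ∧ c ^ 2 = a := by
      by_cases hw : w = 0
      · have hz : z = 0 := by simpa [hw] using hzw
        by_cases hy : y = 0
        · have hx : x = 0 := by simpa [hy] using hxy
          exact absurd ⟨hx, hy, hz, hw⟩ hne
        · refine ⟨x / y, ?_, ?_⟩
          · intro hx
            rw [div_eq_zero_iff, or_iff_left hy] at hx
            apply ha
            have : a * y ^ 2 = 0 := by linear_combination x * hx - hxy
            simpa [hy] using this
          · field_simp
            linear_combination hxy
      · refine ⟨z / w, ?_, ?_⟩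
        · intro hz
          rw [div_eq_zero_iff, or_iff_left hw] at hz
          apply ha
          have : a * w ^ 2 = 0 := by linear_combination z * hz - hzw
          simpa [hw] using this
        · field_simp
          linear_combination hzw
    refine ⟨(1 + b) / 2, (1 - b) / (2 * c), ?_⟩
    have h2 : (2 : F) ≠ 0 := two_ne_zero
    field_simp
    rw [← hc]
    ring
  · refine ⟨(x * z - a * y * w) / (z ^ 2 - a * w ^ 2), (x * w - y * z) / (z ^ 2 - a * w ^ 2), ?_⟩
    field_simp
    linear_combination (z ^ 2 - a * w ^ 2) * h

/-- A non-zero non-unit of `ℍ[F,a,b]` (`a ≠ 0`, `2 ≠ 0`) forces `b = X² - a Y²` to be solvable in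
`F` (Vignéras I §2, proof of Cor. 2.4: a non-zero element of reduced norm `0` in `{L, θ}` gives
`θ ∈ n(L)`). [cite: VignerasLNM800, Ch. I §2 Cor. 2.4] -/
theorem exists_sq_sub_mul_sq_of_not_isUnit [NeZero (2 : F)] {a b : F} (ha : a ≠ 0)
    {q : ℍ[F,a,b]} (hq : q ≠ 0) (hu : ¬ IsUnit q) : ∃ X Y : F, X ^ 2 - a * Y ^ 2 = b := by
  refine exists_sq_sub_mul_sq_of_normForm_eq_zero ha
    (not_not.mp (mt (isUnit_of_normForm_ne_zero q) hu)) fun ⟨h1, h2, h3, h4⟩ ↦ hq ?_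
  exact _root_.QuaternionAlgebra.ext h1 h2 h3 h4

/-- **Characterisation of matrix algebras** (Vignéras I §2, Cor. 2.4): over a field `F` with
`2 ≠ 0`, for `a b ≠ 0`, the quaternion algebra `ℍ[F,a,b] = {F(√a), b}` is isomorphic to `M₂(F)`
if and only if `b = x² - a y²` for some `x y ∈ F` (i.e. `F(√a)` is not a field or `b ∈ n(F(√a))`).
`⇐`: the matrices `i = (0 a; 1 0)`, `j = (x, -a y; y, -x)` satisfy `i² = a`, `j² = b`, `ij = -ji`,
and the induced algebra map is injective by simplicity, bijective by dimension `4 = 4`.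
`⇒`: the preimage of `E₁₁` is a non-zero non-unit. [cite: VignerasLNM800, Ch. I §2 Cor. 2.4] -/
theorem nonempty_algEquiv_matrix_iff [NeZero (2 : F)] {a b : F} (ha : a ≠ 0) (hb : b ≠ 0) :
    Nonempty (ℍ[F,a,b] ≃ₐ[F] Matrix (Fin 2) (Fin 2) F) ↔ ∃ x y : F, x ^ 2 - a * y ^ 2 = b := by
  constructor
  · rintro ⟨e⟩
    -- the matrix unit `E₁₁` is a non-zero non-unit, hence so is its preimage in `ℍ[F,a,b]`
    have hE0 : (!![1, 0; 0, 0] : Matrix (Fin 2) (Fin 2) F) ≠ 0 := fun h ↦ by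
      simpa using congr_fun (congr_fun h 0) 0
    have hEu : ¬ IsUnit (!![1, 0; 0, 0] : Matrix (Fin 2) (Fin 2) F) := by
      rw [Matrix.isUnit_iff_isUnit_det, Matrix.det_fin_two_of]
      simp
    refine exists_sq_sub_mul_sq_of_not_isUnit ha (q := e.symm !![1, 0; 0, 0]) ?_ ?_
    · exact fun h ↦ hE0 (by simpa using congr_arg e h)
    · exact fun h ↦ hEu (by simpa using h.map e)
  · rintro ⟨x, y, hxy⟩
    let B : _root_.QuaternionAlgebra.Basis (R := F) (Matrix (Fin 2) (Fin 2) F) a 0 b :=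
      { i := !![0, a; 1, 0]
        j := !![x, -a * y; y, -x]
        k := !![a * y, -a * x; x, -a * y]
        i_mul_i := by
          ext i j
          fin_cases i <;> fin_cases j <;> simp [Matrix.mul_apply, Fin.sum_univ_two]
        j_mul_j := by
          ext i j
          fin_cases i <;> fin_cases j <;> simp [Matrix.mul_apply, Fin.sum_univ_two] <;>
            first | ring1 | linear_combination hxy
        i_mul_j := by
          ext i j
          fin_cases i <;> fin_cases j <;> simp [Matrix.mul_apply, Fin.sum_univ_two]
        j_mul_i := by
          ext i j
          fin_cases i <;> fin_cases j <;> simp [Matrix.mul_apply, Fin.sum_univ_two] <;> ring }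
    haveI := QuaternionAlgebra.isSimpleRing ha hb
    have hinj : Function.Injective B.liftHom := RingHom.injective B.liftHom.toRingHom
    have hsurj : Function.Surjective B.liftHom :=
      (LinearMap.injective_iff_surjective_of_finrank_eq_finrank (f := B.liftHom.toLinearMap)
        (by simp [Module.finrank_matrix, _root_.QuaternionAlgebra.finrank_eq_four])).mp hinj
    exact ⟨AlgEquiv.ofBijective B.liftHom ⟨hinj, hsurj⟩⟩

end QuaternionAlgebra

/-- Splitting of `ℍ[K,a,b]` over a field extension `F` of `K` with `2 ≠ 0` (`a b ≠ 0`):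
`F ⊗_K ℍ[K,a,b] ≃ M₂(F)` iff `b = x² - a y²` is solvable in `F` (base change
`ScalarExtension.nonempty_algEquiv_quaternionAlgebra` followed by
`QuaternionAlgebra.nonempty_algEquiv_matrix_iff`; Vignéras I §2 Cor. 2.4 applied to `H_F`).
[cite: VignerasLNM800, Ch. I §2 Cor. 2.4] -/
theorem ScalarExtension.nonempty_algEquiv_matrix_iff {K : Type*} [Field K] (F : Type*) [Field F]
    [Algebra K F] [NeZero (2 : F)] {a b : K} (ha : a ≠ 0) (hb : b ≠ 0) :
    Nonempty (ScalarExtension K F ℍ[K,a,b] ≃ₐ[F] Matrix (Fin 2) (Fin 2) F) ↔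
      ∃ x y : F, x ^ 2 - algebraMap K F a * y ^ 2 = algebraMap K F b := by
  obtain ⟨e⟩ := ScalarExtension.nonempty_algEquiv_quaternionAlgebra K F a b
  rw [← QuaternionAlgebra.nonempty_algEquiv_matrix_iff ((map_ne_zero _).mpr ha)
    ((map_ne_zero _).mpr hb)]
  exact ⟨fun ⟨f⟩ ↦ ⟨e.symm.trans f⟩, fun ⟨f⟩ ↦ ⟨e.trans f⟩⟩

end Splitting

/-! ### Places of a number field: local splitting of `ℍ[K,a,b]`, local non-squares -/

section NumberField

variable (K : Type) [Field K] [NumberField K]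

/-- `ℍ[K,a,b]` (`a b ≠ 0`) is split at the finite place `v` iff `b = x² - a y²` is solvable in
`K_v` (Vignéras I Cor. 2.4 over `K_v`; `2 ≠ 0` in `K_v` since `K ⊆ K_v` has characteristic `0`).
[cite: VignerasLNM800, Ch. I §2 Cor. 2.4] -/
theorem isSplitAt_quaternionAlgebra_iff {a b : K} (ha : a ≠ 0) (hb : b ≠ 0)
    (v : HeightOneSpectrum (𝓞 K)) :
    IsSplitAt ℍ[K,a,b] v ↔ ∃ x y : v.adicCompletion K,
      x ^ 2 - algebraMap K _ a * y ^ 2 = algebraMap K _ b := by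
  haveI : CharZero (v.adicCompletion K) :=
    charZero_of_injective_algebraMap (algebraMap K _).injective
  exact ScalarExtension.nonempty_algEquiv_matrix_iff (v.adicCompletion K) ha hb

/-- `ℍ[K,a,b]` (`a b ≠ 0`) is split at the infinite place `w` iff `b = x² - a y²` is solvable in
`K_w` (Vignéras I Cor. 2.4 over `K_w`). [cite: VignerasLNM800, Ch. I §2 Cor. 2.4] -/
theorem isSplitAtInfinite_quaternionAlgebra_iff {a b : K} (ha : a ≠ 0) (hb : b ≠ 0)
    (w : InfinitePlace K) :
    IsSplitAtInfinite ℍ[K,a,b] w ↔ ∃ x y : w.Completion,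
      x ^ 2 - algebraMap K _ a * y ^ 2 = algebraMap K _ b := by
  haveI : CharZero w.Completion := charZero_of_injective_algebraMap (algebraMap K _).injective
  exact ScalarExtension.nonempty_algEquiv_matrix_iff w.Completion ha hb

/-- An element of odd (normalised: `= 1`) valuation at `v` is not a square in the completion
`K_v`: the valuation of `K_v` extends `v` (Mathlib `adicCompletion.valued_coe`) and squares have
even valuation. [folklore] -/
theorem not_isSquare_adicCompletion_of_valuation_eq_exp_neg_one (v : HeightOneSpectrum (𝓞 K))
    {a : K} (ha : v.valuation K a = WithZero.exp (-1)) :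
    ¬ IsSquare (algebraMap K (v.adicCompletion K) a) := by
  rintro ⟨x, hx⟩
  have h := congr_arg Valued.v hx
  rw [HeightOneSpectrum.algebraMap_adicCompletion, Function.comp_apply, Algebra.algebraMap_self,
    RingHom.id_apply, HeightOneSpectrum.adicCompletion.valued_coe, ha, map_mul] at h
  have hx0 : Valued.v x ≠ 0 := by
    intro h0
    rw [h0, mul_zero] at h
    exact WithZero.exp_ne_zero h
  rw [← WithZero.exp_log hx0, ← WithZero.exp_add, WithZero.exp_inj] at h
  omega

omit [NumberField K] in
/-- An element that is negative under the real embedding of a real place `w` is not a square in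
the completion `K_w` (apply the extension `K_w →+* ℝ` of the embedding, Mathlib
`Completion.extensionEmbeddingOfIsReal`). [folklore] -/
theorem not_isSquare_completion_of_embedding_neg {w : InfinitePlace K} (hw : w.IsReal)
    {a : K} (ha : InfinitePlace.embedding_of_isReal hw a < 0) :
    ¬ IsSquare (algebraMap K w.Completion a) := by
  rintro ⟨x, hx⟩
  have h := congr_arg (InfinitePlace.Completion.extensionEmbeddingOfIsReal hw) hx
  simp only [map_mul] at h
  rw [InfinitePlace.Completion.algebraMap_apply] at h
  simp only [InfinitePlace.Completion.extensionEmbeddingOfIsReal_coe, WithAbs.equiv_apply] at h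
  nlinarith [mul_self_nonneg (InfinitePlace.Completion.extensionEmbeddingOfIsReal hw x), h, ha]

/-- For a finite set `S` of finite places of a number field `K` there is `a ∈ K×` with `v(a) = 1`
for all `v ∈ S` and `σ_w(a) < 0` for every real place `w`: take `y ∈ 𝓞 K` congruent to a
uniformiser modulo `v²` for `v ∈ S` (Chinese remainder theorem, Mathlib
`IsDedekindDomain.exists_forall_sub_mem_ideal`) and subtract a large multiple of the positive
integer `N = ∏_{v ∈ S} N(v)² ∈ v²`. (The elementary case of Vignéras III §3 Lemme 3.6:
a quadratic extension `K(√a)` that is a field at prescribed places.) [folklore] -/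
theorem exists_valuation_eq_exp_neg_one_and_embedding_neg
    (S : Finset (HeightOneSpectrum (𝓞 K))) :
    ∃ a : K, a ≠ 0 ∧ (∀ v ∈ S, v.valuation K a = WithZero.exp (-1)) ∧
      ∀ (w : InfinitePlace K) (hw : w.IsReal), InfinitePlace.embedding_of_isReal hw a < 0 := by
  classical
  -- uniformisers `π v ∈ 𝓞 K`
  choose π hπ using fun v : HeightOneSpectrum (𝓞 K) ↦ v.intValuation_exists_uniformizer
  -- CRT: `y ≡ π v (mod v²)` for `v ∈ S`
  obtain ⟨y, hy⟩ := IsDedekindDomain.exists_forall_sub_mem_ideal (s := S) (fun v ↦ v.asIdeal)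
    (fun _ ↦ 2) (fun v _ ↦ v.prime) (fun v _ v' _ hne h ↦ hne (HeightOneSpectrum.ext h))
    (fun v ↦ π v.1)
  -- a positive integer `N ∈ v²` for all `v ∈ S`
  set N : ℕ := ∏ v ∈ S, Ideal.absNorm v.asIdeal ^ 2 with hN
  have hN0 : 0 < N := by
    refine Finset.prod_pos fun v _ ↦ pow_pos (Nat.pos_of_ne_zero ?_) 2
    rw [Ne, Ideal.absNorm_eq_zero_iff]
    exact v.ne_bot
  have hNmem : ∀ v ∈ S, ∀ k : ℕ, ((k * N : ℕ) : 𝓞 K) ∈ v.asIdeal ^ 2 := by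
    intro v hv k
    obtain ⟨m, hm⟩ := Finset.dvd_prod_of_mem (fun v : HeightOneSpectrum (𝓞 K) ↦
      Ideal.absNorm v.asIdeal ^ 2) hv
    rw [← hN] at hm
    rw [hm]
    push_cast
    rw [mul_comm (k : 𝓞 K), mul_assoc]
    exact Ideal.mul_mem_right _ _ (Ideal.pow_mem_pow (Ideal.absNorm_mem _) 2)
  -- valuations of `y - k N` at `v ∈ S`
  have hval : ∀ v ∈ S, ∀ k : ℕ, v.intValuation (y - (k * N : ℕ)) = WithZero.exp (-1) := by
    intro v hv k
    have h1 : v.intValuation (y - π v) ≤ WithZero.exp (-((2 : ℕ) : ℤ)) :=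
      (v.intValuation_le_pow_iff_mem _ 2).mpr (hy v hv)
    have h2 : v.intValuation ((k * N : ℕ) : 𝓞 K) ≤ WithZero.exp (-((2 : ℕ) : ℤ)) :=
      (v.intValuation_le_pow_iff_mem _ 2).mpr (hNmem v hv k)
    have h3 : v.intValuation (y - π v - (k * N : ℕ)) < v.intValuation (π v) := by
      refine lt_of_le_of_lt (Valuation.map_sub_le _ h1 h2) ?_
      rw [hπ]
      exact WithZero.exp_lt_exp.mpr (by norm_num)
    have : y - ((k * N : ℕ) : 𝓞 K) = π v + (y - π v - (k * N : ℕ)) := by ring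
    rw [this, Valuation.map_add_eq_of_lt_left _ h3, hπ]
  -- choose `k` with `w y < k ≤ k N` for every infinite place `w`
  obtain ⟨k, hk⟩ : ∃ k : ℕ, ∀ w : InfinitePlace K, w (y : K) < k := by
    obtain ⟨k, hk⟩ := exists_nat_gt (∑ w : InfinitePlace K, w (y : K))
    exact ⟨k, fun w ↦ lt_of_le_of_lt
      (Finset.single_le_sum (fun w _ ↦ apply_nonneg w (y : K)) (Finset.mem_univ w)) hk⟩
  have hkN : ∀ w : InfinitePlace K, w (y : K) < (k * N : ℕ) := fun w ↦
    lt_of_lt_of_le (hk w) (by exact_mod_cast Nat.le_mul_of_pos_right k hN0)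
  refine ⟨((y - ((k * N : ℕ) : 𝓞 K) : 𝓞 K) : K), ?_, ?_, ?_⟩
  · -- non-zero: `w y < k N = w (k N)` at any infinite place `w`
    obtain ⟨w⟩ := (inferInstance : Nonempty (InfinitePlace K))
    intro h
    have hyk : ((y : 𝓞 K) : K) = ((k * N : ℕ) : K) := by
      rw [← sub_eq_zero]
      exact_mod_cast h
    have := hkN w
    rw [hyk, ← InfinitePlace.norm_embedding_eq, map_natCast, Complex.norm_natCast] at this
    exact lt_irrefl _ this
  · intro v hv
    rw [show ((y - ((k * N : ℕ) : 𝓞 K) : 𝓞 K) : K) = algebraMap (𝓞 K) K (y - ((k * N : ℕ) : 𝓞 K))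
      from rfl, HeightOneSpectrum.valuation_of_algebraMap]
    exact hval v hv k
  · intro w hw
    have h1 : InfinitePlace.embedding_of_isReal hw (y : K) < (k * N : ℕ) := by
      refine lt_of_le_of_lt (le_abs_self _) ?_
      rw [← Real.norm_eq_abs, InfinitePlace.norm_embedding_of_isReal]
      exact hkN w
    push_cast
    rw [map_sub]
    simp only [map_natCast, map_mul]
    push_cast at h1
    linarith

/-! ### Assembly: the classification (existence half) from the quadratic norm theorem -/

/-- **Existence of a quaternion algebra with prescribed even ramification, reduced to the norm
index theorem for quadratic extensions** (Vignéras III §3: Thm. 3.1, existence half, via Thm. 3.7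
and the proof of Thm. 3.8). Hypothesis `h` is the statement extracted by Vignéras from
`[K_A^× : K^× n(L_A^×)] = 2` (Thm. 3.7) in the proofs of Thm. 3.8 and Propriété III, for
`L = K(√a)`: if `a` is a non-square in `K_v` for `v ∈ S` and in `K_w` for `w ∈ T` and `|S| + |T|`
is even, then `K^× ∩ ∏_{v ∈ S ∪ T} i_v n(L_A^×) ≠ ∅`, i.e. some `θ ∈ K×` is of the form
`x² - a y²` over `K_v` exactly for `v ∉ S ∪ T` (in Hilbert-symbol form this is O'Meara 71:19
with 71:19a, the named fact `Literature.NumberTheory.QuadraticForms.exists_hilbertSymbol_eq_neg_one_iff` of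
`Literature/NumberTheory/QuadraticForms/HilbertSymbolPrescribed.lean`; the sibling file
`QuaternionAlgebraExistence.lean` has the version taking that fact as hypothesis). Proof: choose
`a` with `v(a) = 1` on `S` and `a < 0` at all real places
(`exists_valuation_eq_exp_neg_one_and_embedding_neg`), so that `a` is a local non-square on
`S ∪ T`; take `θ` from `h`; then `ℍ[K,a,θ]` is a quaternion
algebra (`QuaternionAlgebra.isQuaternionAlgebra_holds`) which by
`isSplitAt_quaternionAlgebra_iff`/`isSplitAtInfinite_quaternionAlgebra_iff` is ramified exactly at
`S` and `T`. [cite: VignerasLNM800, Ch. III §3 Thm. 3.1 (existence), Thm. 3.7, proof of Thm. 3.8] -/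
theorem exists_isQuaternionAlgebra_of_even_of_exists_isLocalNorm
    (h : ∀ (a : K) (S : Finset (HeightOneSpectrum (𝓞 K))) (T : Finset (InfinitePlace K))
      (_hS : ∀ v ∈ S, ¬ IsSquare (algebraMap K (v.adicCompletion K) a))
      (_hT : ∀ w ∈ T, ¬ IsSquare (algebraMap K w.Completion a))
      (_hST : Even (S.card + T.card)),
      ∃ θ : K, θ ≠ 0 ∧
        (∀ v : HeightOneSpectrum (𝓞 K),
          (∃ x y : v.adicCompletion K, x ^ 2 - algebraMap K _ a * y ^ 2 = algebraMap K _ θ) ↔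
            v ∉ S) ∧
        (∀ w : InfinitePlace K,
          (∃ x y : w.Completion, x ^ 2 - algebraMap K _ a * y ^ 2 = algebraMap K _ θ) ↔
            w ∉ T)) :
    exists_isQuaternionAlgebra_of_even K := by
  intro S T hTreal hST
  obtain ⟨a, ha0, haS, haT⟩ := exists_valuation_eq_exp_neg_one_and_embedding_neg K S
  have hS : ∀ v ∈ S, ¬ IsSquare (algebraMap K (v.adicCompletion K) a) := fun v hv ↦
    not_isSquare_adicCompletion_of_valuation_eq_exp_neg_one K v (haS v hv)
  have hT : ∀ w ∈ T, ¬ IsSquare (algebraMap K w.Completion a) := fun w hw ↦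
    not_isSquare_completion_of_embedding_neg K (hTreal w hw) (haT w (hTreal w hw))
  obtain ⟨θ, hθ0, hfin, hinf⟩ := h a S T hS hT hST
  refine ⟨ℍ[K,a,θ], inferInstance, inferInstance,
    QuaternionAlgebra.isQuaternionAlgebra_holds ha0 hθ0, ?_, ?_⟩
  · ext v
    rw [mem_ramifiedPlaces_iff, Finset.mem_coe, isSplitAt_quaternionAlgebra_iff K ha0 hθ0, hfin v,
      not_not]
  · ext w
    rw [mem_ramifiedInfinitePlaces_iff, Finset.mem_coe,
      isSplitAtInfinite_quaternionAlgebra_iff K ha0 hθ0, hinf w, not_not]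

end NumberField

end Literature.NumberTheory.Automorphic
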